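import Mathlib.Analysis.Complex.ExponentialBounds
import Literature.NumberTheory.ConnesConsani2021.JumpFormula
import HarnessLib

/-!
# Connes–Consani 2021, Theorem 6.11 / eq. (4) and Theorem 1 — the proof of p. 29 ASSEMBLED:
# the named facts `WeilArchPositivity_soninTrace[_fine]` from exactly the residual printed inputs

A. Connes, C. Consani, *Weil positivity and trace formula, the archimedean place*, Selecta Math.
(N.S.) 27 (2021), Paper No. 77 = arXiv:2006.13771 [bib: `ConnesConsani2021`], §6.7, Theorem 6.11
(= Thm. 44 of the arXiv text, p. 28, proof p. 29), eq. (4) of the Introduction (p. 4), Theorem 1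
(Intro p. 4) and Lemma 6.10 (= Lemma 43, p. 28).

**What is printed** (Thm. 6.11 and its proof, pp. 28–29).  "Let `g ∈ C_c^∞(ℝ₊*)` be a smooth function
with support in the interval `[2^{-1/2}, 2^{1/2}]` and whose Fourier transform vanishes at `−i/2` … Then
`W_∞(g ∗ g*) ≥ Tr(ϑ(g) 𝐒 ϑ(g)*) − c|ĝ(0)|²`, `c = 4γ/log 2`.  *Proof.* By Theorem 4.7 one has, for
`f = g ∗ g*`, (sonine1thm) `Tr(ϑ(f)𝐒) = W_∞(f) + ∫ f(ρ⁻¹)ε(ρ)d*ρ = W_∞(f) + E(f)`.  Let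
`k(u) := u^{1/2}∫₀^u v^{-1/2} g(v) d*v` … `Q(k ∗ k*) = g ∗ g* = f`, `k̂(0) = −2ĝ(0)` … One thus obtains
`∫ f(ρ⁻¹)ε(ρ)d*ρ = E∘Q(k ∗ k*)`.  Let `ξ(x) := k(exp(x))`.  One has `ξ ∈ 𝓗 = L²([−½log 2, ½log 2])` and
using (quadform) of Proposition 5.5, `E∘Q(k ∗ k*) = E₊(Q₊(ξ ∗ ξ*)) = ⟨ξ|N_I(ξ)⟩`.  Then, by Lemma 6.10
one gets, using `⟨η₀|ξ⟩ = (log 2)^{-1/2} ξ̂(0) = (log 2)^{-1/2} k̂(0)`,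
`E(f) = E∘Q(k ∗ k*) = ⟨ξ|N_I(ξ)⟩ ≤ γ|⟨η₀|ξ⟩|² = (γ/log 2)|k̂(0)|² = (4γ/log 2)|ĝ(0)|²`, which gives the
required inequality."  Lemma 6.10 (p. 28): "`⟨N_I(ξ)|ξ⟩ ≤ γ|⟨η₀|ξ⟩|²` for all `ξ ∈ 𝓗`, with
`γ ≃ 2.94355`", obtained in its proof as `γ = 2aε′(1₊)` from
"`⟨ξ|(1 − 𝐊_I)ξ⟩ + a|⟨η₀|ξ⟩|² ≥ (ε₂ − ε₁)‖ξ‖²`", `a ≃ 0.064`, `ε′(1₊) ≃ 22.9965` (Lemma 5.4),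
"after multiplication by `−2ε′(1₊)`".  Theorem 1 is the case `ĝ(0) = 0` (Intro p. 4).

**What is PROVED here** (the assembly, 0 named facts introduced).  The earlier files of this folder
kernel-check every analytic link of this proof GENERICALLY in the even density: Lemma 3.1 / the step
`k = Y ∗ g` (`VanishingIdealReduction.exists_halfPrimitive`), Prop. 5.5 (`JumpFormula`: for `E₊` the
functional with even density `G(|x|)`, `G ∈ C²`, `G′(0) = e′` — CC: `G = ε∘exp` on `[0,∞)`, `e′ = ε′(1₊)`
— one has `E₊(Q₊(k ∗ k*)) = ⟨ξ|N ξ⟩`, `N = opN = −2e′(1 − 𝐊_I)`, `𝐊_I = windowOp ϖ_G`), Lemma 6.3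
(`KernelApproximation`), Lemma 6.9 / 6.10 and the p. 28 spectral step (`RankOnePositivity`).  This file
puts them together exactly as on p. 29 and reaches the tree's two cited named facts
(`ArchimedeanSoninTrace.WeilArchPositivity_soninTrace_fine`, `…_soninTrace`) as CONCLUSIONS of
theorems whose hypotheses are precisely the residual printed inputs, stated in the statement layer's
own weak-trace typing ("How the trace is typed", `ArchimedeanSoninTrace` module docstring):

* (H-TF) **Theorem 4.7 for `f = g ∗ g*`** (eq. (sonine1thm)), weak form: for every finite orthonormal
  family `(ξ_i)` in Sonin's space `S(1,1)`, `Σ_i Re⟨ξ_i|ϑ(g ∗ g*)ξ_i⟩ ≤ Re W_∞(g ∗ g*) + Re E₊(g ∗ g*)`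
  (each partial sum of the trace of the positive operator `𝐒ϑ(g)ϑ(g)*𝐒` is `≤ Tr(ϑ(g)𝐒ϑ(g)*)
  = W_∞ + E`; `E(f) = ∫ f(ρ⁻¹)ε(ρ)d*ρ = ∫ F(x) ε(e^{|x|}) dx = E₊(F)` for the additive avatar `F`, by
  `ε(ρ⁻¹) = ε(ρ)` — the identification "`E∘Q(k ∗ k*) = E₊(Q₊(ξ ∗ ξ*))`" of p. 29);
* (H-ε) **the density**: `G ∈ C²(ℝ)` with `G′(0) = e′ ≠ 0` (resp. `> 0`) — in print `ε∘exp`, smooth on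
  `[0, ∞)` (Lemma 5.2, Prop. 5.3, App. E), `ε′(1₊) ≃ 22.9965` (Lemma 5.4);
* (H-NI) **Lemma 6.10's (negativeNI)** `Re⟨ξ|N ξ⟩ ≤ γ|⟨η₀|ξ⟩|²` on `𝓗 = L²(I)` — derived here
  (`re_inner_opN_le_of_opIneq`) from the sign-free operator inequality
  (H-op) `⟨ξ|(1 − 𝐊_I)ξ⟩ + a₀|⟨η₀|ξ⟩|² ≥ 0` with `γ = 2a₀e′`, itself derived
  (`opIneq_of_selfAdjoint_eigenvector`, `opIneq_of_rankOne_decomposition`) from the §6 spectral data of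
  a self-adjoint finite-rank `T` with top eigenpair `(η, λ_max)`, `⟨ζ|Tζ⟩ ≤ λ₂‖ζ‖²` on `η^⊥`,
  `‖𝐊_I − T‖ ≤ ε₁ ≤ ε₂` (in print: the floating-point values `λ_max = 1.05158`, `λ₂ ≤ 0.772216`,
  `⟨η₀|η⟩ ≃ 0.94865`, `ε₁ ≃ 0.00122`, `a ≃ 0.064`; NOT certified here or in print);
* (H-c) **the arithmetic** `8a₀e′/log 2 < 17`: at the printed `a = 0.064`, `ε′(1₊) = 22.9965` the
  constant `c = 4γ/log 2 = 8aε′(1₊)/log 2` lies in `(16.98, 17)` — `printedConstants_mainInequality`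
  (certified with Mathlib's `Real.log_two_gt_d9` / `…_lt_d9`).

Theorems: `soninTrace_sub_le_archW_of_negativity` (Thm. 6.11 for one `g`, literally as on p. 29:
(H-TF) + (H-ε) + (H-NI) ⇒ `Σ_i Re⟨ξ_i|ϑ(g∗g*)ξ_i⟩ − (4γ/log 2)|ĝ(0)|² ≤ Re W_∞(g ∗ g*)`),
`weilArchPositivity_soninTrace_fine_of_negativity` / `…_of_opIneq` / `…_of_spectralData` (eq. (4):
the named fact `WeilArchPositivity_soninTrace_fine` from (H-TF) for all admissible `g`, (H-ε),
(H-NI)/(H-op)/spectral data, (H-c)), and for Theorem 1 the sharper `weilArchPositivity_soninTrace_of_perp`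
(no constant needed: (H-TF) + (H-ε) with `e′ > 0` + `⟨ξ|(1 − 𝐊_I)ξ⟩ ≥ 0` on `η₀^⊥` ⇒
`WeilArchPositivity_soninTrace`, since `ĝ(0) = 0` makes `ξ = k|_I ⊥ η₀`) and `…_of_opIneq`.
So the residual content of the two named facts is kernel-located: Theorem 4.7 (the trace formula,
quantized calculus and prolate theory: not in Mathlib), the prolate description of `ε` with the value
`ε′(1₊)`, and the floating-point spectral inputs of §6 (cell `pub-rhdoor`, `HOME/lit/CC2021-RIGOUR-MAP.md`
§4 W3–W6).  This file discharges neither fact and introduces none (net debt delta 0); no RH claim;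
framing of the cell: lottery ticket at the motivic door; RH probability negligible; consolation prizes are
real (a typed and, where tractable, PROVED skeleton of the published record).
-/

noncomputable section

open MeasureTheory Set Complex Filter
open scoped ComplexConjugate InnerProductSpace

namespace Literature.NumberTheory.ConnesConsani2021

open Literature.NumberTheory.LFunctions

/-! ## (H-op): the sign-free operator inequality from Lemma 6.10's spectral data (generic Hilbert space) -/

section OperatorInequality

variable {𝕜 : Type*} {E : Type*} [RCLike 𝕜] [NormedAddCommGroup E] [InnerProductSpace 𝕜 E]
variable {K T R : E →L[𝕜] E} {η φ₀ : E} {lmax l₂ a₀ ε₁ : ℝ}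

/-- **Lemma 6.10's inequality in sign-free form**, from the decomposition `T = λ_max|η⟩⟨η| + R`,
`R ≤ λ₂P_η`, `‖K − T‖ ≤ ε₁` and `ε₁ ≤ ε₂` (p. 28: "`⟨ξ|(1 − 𝐊_I)ξ⟩ + a|⟨η₀|ξ⟩|² ≥ (ε₂ − ε₁)‖ξ‖²`",
with "`ε₁ ≃ 0.00122 < ε₂`"): `0 ≤ Re⟨ξ|(1 − K)ξ⟩ + a|⟨η₀|ξ⟩|²` for every `ξ`.
[cite: ConnesConsani2021, Lemma 6.10 §6.7 p. 28 (proof)] -/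
theorem opIneq_of_rankOne_decomposition (hη : ‖η‖ = 1) (hφ₀ : ‖φ₀‖ = 1)
    (hlmax : 1 ≤ lmax) (hl₂ : l₂ ≤ 1) (ha₀ : 0 ≤ a₀)
    (hT : ∀ ξ, T ξ = ((lmax : ℝ) : 𝕜) • ⟪η, ξ⟫_𝕜 • η + R ξ)
    (hR : ∀ ξ, RCLike.re ⟪ξ, R ξ⟫_𝕜 ≤ l₂ * ‖(𝕜 ∙ η)ᗮ.starProjection ξ‖ ^ 2)
    (hKT : ‖K - T‖ ≤ ε₁) (hε : ε₁ ≤ rankOneGap a₀ (lmax - 1) (1 - l₂) ‖⟪η, φ₀⟫_𝕜‖) (ξ : E) :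
    0 ≤ RCLike.re ⟪ξ, ξ - K ξ⟫_𝕜 + a₀ * ‖⟪φ₀, ξ⟫_𝕜‖ ^ 2 :=
  (mul_nonneg (sub_nonneg.2 hε) (sq_nonneg _)).trans
    (re_inner_sub_le_of_rankOne_decomposition hη hφ₀ hlmax hl₂ ha₀ hT hR hKT ξ)

/-- **Lemma 6.10's inequality in sign-free form from the printed spectral data of a self-adjoint `T`**
(p. 28: `T` symmetric with top eigenpair `Tη = λ_max η`, `‖η‖ = 1`, `λ_max ≥ 1`; `⟨ζ|Tζ⟩ ≤ λ₂‖ζ‖²`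
on `η^⊥`, `λ₂ ≤ 1`; a unit vector `η₀`; `a ≥ 0`; `‖K − T‖ ≤ ε₁ ≤ ε₂ = rankOneGap a (λ_max − 1) (1 − λ₂) |⟨η|η₀⟩|`):
`0 ≤ Re⟨ξ|(1 − K)ξ⟩ + a|⟨η₀|ξ⟩|²`.  In the source `K = 𝐊_I`, `T` the finite-rank operator of (opT)
with the floating-point values `λ_max = 1.05158` (Lemma 6.4), `λ₂ ≤ 0.772216` (Lemma 6.8 (iii)),
`⟨η₀|η⟩ ≃ 0.94865` (Fact 6.5), `ε₁ ≃ 0.00122` (Fact 6.1, Lemma 6.3), `a ≃ 0.064`; none certified here.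
[cite: ConnesConsani2021, Lemma 6.10 §6.7 p. 28 (proof)] -/
theorem opIneq_of_selfAdjoint_eigenvector (hη : ‖η‖ = 1) (hφ₀ : ‖φ₀‖ = 1)
    (hlmax : 1 ≤ lmax) (hl₂ : l₂ ≤ 1) (ha₀ : 0 ≤ a₀)
    (hsa : ∀ x y : E, ⟪T x, y⟫_𝕜 = ⟪x, T y⟫_𝕜) (heig : T η = ((lmax : ℝ) : 𝕜) • η)
    (hTl₂ : ∀ ζ : E, ⟪η, ζ⟫_𝕜 = 0 → RCLike.re ⟪ζ, T ζ⟫_𝕜 ≤ l₂ * ‖ζ‖ ^ 2)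
    (hKT : ‖K - T‖ ≤ ε₁) (hε : ε₁ ≤ rankOneGap a₀ (lmax - 1) (1 - l₂) ‖⟪η, φ₀⟫_𝕜‖) (ξ : E) :
    0 ≤ RCLike.re ⟪ξ, ξ - K ξ⟫_𝕜 + a₀ * ‖⟪φ₀, ξ⟫_𝕜‖ ^ 2 :=
  (mul_nonneg (sub_nonneg.2 hε) (sq_nonneg _)).trans
    (re_inner_sub_le_of_selfAdjoint_eigenvector hη hφ₀ hlmax hl₂ ha₀ hsa heig hTl₂ hKT ξ)

/-- On `η₀^⊥` the sign-free inequality is plain positivity of `1 − K` (the case used for Theorem 1,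
where `ĝ(0) = 0` forces `ξ ⊥ η₀`). [cite: ConnesConsani2021, §6.7 p. 29 (proof of Thm. 6.11); Intro p. 4] -/
theorem re_inner_sub_nonneg_of_opIneq
    (hpos : ∀ ξ, 0 ≤ RCLike.re ⟪ξ, ξ - K ξ⟫_𝕜 + a₀ * ‖⟪φ₀, ξ⟫_𝕜‖ ^ 2) {ξ : E}
    (hξ : ⟪φ₀, ξ⟫_𝕜 = 0) : 0 ≤ RCLike.re ⟪ξ, ξ - K ξ⟫_𝕜 := by
  simpa [hξ] using hpos ξ

end OperatorInequality

/-! ## (H-NI) from (H-op): "after multiplication by `−2ε′(1₊)`" (end of the proof of Lemma 6.10) -/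

section Window

variable {G k : ℝ → ℂ} {a b : ℝ}

/-- **End of the proof of Lemma 6.10** (p. 28: "which gives (negativeNI) after multiplication by
`−2ε′(1₊)`"): on `𝓗 = L²(I)`, `I = [a, b]`, with `N = opN = −2e′(1 − 𝐊)`, `𝐊 = windowOp ϖ_G`, `η₀` the
normalized constant (`constVector`), if `⟨ξ|(1 − 𝐊)ξ⟩ + a₀|⟨η₀|ξ⟩|² ≥ 0` for all `ξ` and `e′ = G′(0) ≥ 0`,
then `Re⟨ξ|N ξ⟩ ≤ γ|⟨η₀|ξ⟩|²` with `γ = 2a₀e′` (CC: `γ = 2aε′(1₊) ≃ 2.94355`).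
[cite: ConnesConsani2021, Lemma 6.10 §6.7 p. 28 (proof)] -/
theorem re_inner_opN_le_of_opIneq {a₀ e' : ℝ} (hG : ContDiff ℝ 2 G) (hGe : deriv G 0 = e')
    (he' : 0 ≤ e')
    (hpos : ∀ ξ : Lp ℂ 2 (volume.restrict (Icc a b)),
      0 ≤ RCLike.re ⟪ξ, ξ - windowOp a b (integrableOn_varpi hG a b) ξ⟫_ℂ
            + a₀ * ‖⟪constVector a b, ξ⟫_ℂ‖ ^ 2)
    (ξ : Lp ℂ 2 (volume.restrict (Icc a b))) :
    RCLike.re ⟪ξ, opN hG a b ξ⟫_ℂ ≤ 2 * a₀ * e' * ‖⟪constVector a b, ξ⟫_ℂ‖ ^ 2 := by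
  have h := hpos ξ
  simp only [RCLike.re_to_complex] at h ⊢
  rw [opN_apply, hGe, inner_smul_right]
  have e : (-(2 * (e' : ℂ))) = ((-(2 * e') : ℝ) : ℂ) := by push_cast; ring
  rw [e, Complex.re_ofReal_mul]
  have h2 : 0 ≤ 2 * e' * ((⟪ξ, ξ - windowOp a b (integrableOn_varpi hG a b) ξ⟫_ℂ).re
      + a₀ * ‖⟪constVector a b, ξ⟫_ℂ‖ ^ 2) := mul_nonneg (by linarith) h
  rw [mul_add] at h2
  linarith

/-- **Prop. 5.5 + Lemma 6.10 on a test vector** (the two displays of p. 29 before the constant):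
for a test function `k` with `supp k ⊆ I = [a, b]` and `ξ = k|_I`,
`Re E₊(Q₊(k ∗ k*)) = Re⟨ξ|N ξ⟩ ≤ γ|⟨η₀|ξ⟩|² = (γ/(b − a))|k̂(0)|²`, given (H-NI) with constant `γ`.
[cite: ConnesConsani2021, Thm. 6.11 §6.7 p. 29 (proof); Prop. 5.5 §5 pp. 20–21] -/
theorem re_evenFunctional_opQ_autocorr_le_of_negativity {γ : ℝ} (hG : ContDiff ℝ 2 G)
    (hG0 : deriv G 0 ≠ 0) (hab : a < b) (hk : IsWeilTest k) (hks : tsupport k ⊆ Icc a b)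
    (hNI : ∀ ξ : Lp ℂ 2 (volume.restrict (Icc a b)),
      RCLike.re ⟪ξ, opN hG a b ξ⟫_ℂ ≤ γ * ‖⟪constVector a b, ξ⟫_ℂ‖ ^ 2) :
    (evenFunctional G (opQ (weilConv k (weilReflect k)))).re
      ≤ γ / (b - a) * ‖mulFourier k 0‖ ^ 2 := by
  have h1 := hNI (testVector hk a b)
  rw [norm_inner_constVector_testVector_sq hab hk hks, RCLike.re_to_complex,
    evenFunctional_opQ_autocorr_eq_inner_opN hG hG0 hk hks] at h1
  calc (evenFunctional G (opQ (weilConv k (weilReflect k)))).re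
      ≤ γ * ((b - a)⁻¹ * ‖mulFourier k 0‖ ^ 2) := h1
    _ = γ / (b - a) * ‖mulFourier k 0‖ ^ 2 := by ring

/-- **The case `ξ ⊥ η₀`** (Theorem 1): if `k̂(0) = 0` then `⟨η₀|ξ⟩ = (b − a)^{-1/2}k̂(0) = 0`, and
positivity of `1 − 𝐊` on `η₀^⊥` gives `Re E₊(Q₊(k ∗ k*)) = −2e′ Re⟨ξ|(1 − 𝐊)ξ⟩ ≤ 0` (`e′ = G′(0) > 0`).
[cite: ConnesConsani2021, Thm. 6.11 §6.7 p. 29 (proof); Intro p. 4 (Thm. 1 as the case `ĝ(0) = 0`)] -/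
theorem re_evenFunctional_opQ_autocorr_nonpos_of_perp {e' : ℝ} (hG : ContDiff ℝ 2 G)
    (hGe : deriv G 0 = e') (he' : 0 < e') (hk : IsWeilTest k) (hks : tsupport k ⊆ Icc a b)
    (hk0 : mulFourier k 0 = 0)
    (hperp : ∀ ξ : Lp ℂ 2 (volume.restrict (Icc a b)), ⟪constVector a b, ξ⟫_ℂ = 0 →
      0 ≤ RCLike.re ⟪ξ, ξ - windowOp a b (integrableOn_varpi hG a b) ξ⟫_ℂ) :
    (evenFunctional G (opQ (weilConv k (weilReflect k)))).re ≤ 0 := by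
  have hG0 : deriv G 0 ≠ 0 := by
    rw [hGe]; exact_mod_cast he'.ne'
  have horth : ⟪constVector a b, testVector hk a b⟫_ℂ = 0 := by
    rw [inner_constVector_testVector hk hks, hk0, mul_zero]
  have h1 := hperp _ horth
  simp only [RCLike.re_to_complex] at h1
  rw [evenFunctional_opQ_autocorr_eq_inner hG hG0 hk hks, hGe, inner_smul_right]
  have e : (-(2 * (e' : ℂ))) = ((-(2 * e') : ℝ) : ℂ) := by push_cast; ring
  rw [e, Complex.re_ofReal_mul]
  have h2 : 0 ≤ 2 * e' * (⟪testVector hk a b, testVector hk a b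
      - windowOp a b (integrableOn_varpi hG a b) (testVector hk a b)⟫_ℂ).re :=
    mul_nonneg (by linarith) h1
  linarith

end Window

/-! ## Theorem 6.11 / eq. (4) / Theorem 1 assembled on CC's window `I = [−½ log 2, ½ log 2]` -/

section MainInequality

variable {G g : ℝ → ℂ}

/-- `log 2 > 0`, so the window is a genuine interval. [folklore] -/
private theorem neg_half_log_two_lt : -(Real.log 2 / 2) < Real.log 2 / 2 := by
  have := Real.log_pos (one_lt_two : (1 : ℝ) < 2)
  linarith

/-- The length of CC's window is `log 2`. [folklore] -/
private theorem window_length : Real.log 2 / 2 - -(Real.log 2 / 2) = Real.log 2 := by ring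

/-- **Connes–Consani 2021, Theorem 6.11 — the proof of p. 29 assembled, for one test function.**
Let `E₊` be the functional with even density `G(|x|)`, `G ∈ C²`, `G′(0) ≠ 0` (CC: `G = ε∘exp`,
`G′(0) = ε′(1₊)`), `N = −2G′(0)(1 − 𝐊_I)` on `𝓗 = L²(I)` (`opN`), `η₀` the normalized constant, and
assume Lemma 6.10's (negativeNI): `Re⟨ξ|N ξ⟩ ≤ γ|⟨η₀|ξ⟩|²` on `𝓗`.  Let `g ∈ C_c^∞` have support in
`[−½log 2, ½log 2]` and `ĝ(−i/2) = 0`, and assume Theorem 4.7's (sonine1thm) for `f = g ∗ g*` in the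
weak-trace typing of the statement layer: for the finite orthonormal family `(ξ_i)` at hand,
`Σ_i Re⟨ξ_i|ϑ(f)ξ_i⟩ ≤ Re W_∞(f) + Re E₊(f)`.  Then
`Σ_i Re⟨ξ_i|ϑ(f)ξ_i⟩ − (4γ/log 2)|ĝ(0)|² ≤ Re W_∞(f)` — the printed chain
"`E(f) = E∘Q(k ∗ k*) = ⟨ξ|N_I(ξ)⟩ ≤ γ|⟨η₀|ξ⟩|² = (γ/log 2)|k̂(0)|² = (4γ/log 2)|ĝ(0)|²`" with `k = Y ∗ g`
(`exists_halfPrimitive`: `Q(k ∗ k*) = g ∗ g*`, `k̂(0) = −2ĝ(0)`).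
[cite: ConnesConsani2021, Thm. 6.11 §6.7 pp. 28–29] -/
theorem soninTrace_sub_le_archW_of_negativity {γ : ℝ} (hG : ContDiff ℝ 2 G) (hG0 : deriv G 0 ≠ 0)
    (hNI : ∀ ξ : Lp ℂ 2 (volume.restrict (Icc (-(Real.log 2 / 2)) (Real.log 2 / 2))),
      RCLike.re ⟪ξ, opN hG (-(Real.log 2 / 2)) (Real.log 2 / 2) ξ⟫_ℂ
        ≤ γ * ‖⟪constVector (-(Real.log 2 / 2)) (Real.log 2 / 2), ξ⟫_ℂ‖ ^ 2)
    (hg : IsWeilTest g) (hgs : tsupport g ⊆ Icc (-(Real.log 2 / 2)) (Real.log 2 / 2))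
    (h0 : mulFourier g (-(I / 2)) = 0)
    {n : ℕ} (ξ : Fin n → Lp ℂ 2 (volume : Measure ℝ))
    (hTr : ∑ i, (soninTraceForm (weilConv g (weilReflect g)) (ξ i : ℝ → ℂ)).re
        ≤ (archW (weilConv g (weilReflect g))).re
          + (evenFunctional G (weilConv g (weilReflect g))).re) :
    ∑ i, (soninTraceForm (weilConv g (weilReflect g)) (ξ i : ℝ → ℂ)).re
        - 4 * γ / Real.log 2 * ‖mulFourier g 0‖ ^ 2
      ≤ (archW (weilConv g (weilReflect g))).re := by
  -- `k = Y ∗ g`: `Q(k ∗ k*) = g ∗ g*`, `k̂(0) = −2 ĝ(0)`, `supp k ⊆ I`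
  obtain ⟨k, hk, hks, -, -, hkQ, hk0⟩ := exists_halfPrimitive hg hgs h0
  -- `E(f) = E₊(Q₊(k ∗ k*)) = ⟨ξ|N ξ⟩ ≤ γ|⟨η₀|ξ⟩|² = (γ/log 2)|k̂(0)|²`
  have hE := re_evenFunctional_opQ_autocorr_le_of_negativity hG hG0 neg_half_log_two_lt hk hks hNI
  rw [hkQ, window_length] at hE
  -- `(γ/log 2)|k̂(0)|² = (4γ/log 2)|ĝ(0)|²`
  have hc := thm611_constant_eq hk0 γ
  linarith

/-- **Theorem 6.11 with Lemma 6.10 unfolded to the sign-free operator inequality** (H-op):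
if `G′(0) = e′ > 0` and `⟨ξ|(1 − 𝐊_I)ξ⟩ + a₀|⟨η₀|ξ⟩|² ≥ 0` on `𝓗` (`𝐊_I = windowOp ϖ_G`), then, under
Theorem 4.7's (sonine1thm) for `f = g ∗ g*` (weak form), `Σ_i Re⟨ξ_i|ϑ(f)ξ_i⟩ − (8a₀e′/log 2)|ĝ(0)|²
≤ Re W_∞(f)`: `γ = 2a₀e′`, `c = 4γ/log 2 = 8a₀e′/log 2` (printed: `a ≃ 0.064`, `ε′(1₊) ≃ 22.9965`,
`γ ≃ 2.94355`, `c ≃ 16.99`). [cite: ConnesConsani2021, Thm. 6.11 §6.7 pp. 28–29; Lemma 6.10 p. 28] -/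
theorem soninTrace_sub_le_archW_of_opIneq {a₀ e' : ℝ} (hG : ContDiff ℝ 2 G) (hGe : deriv G 0 = e')
    (he' : 0 < e')
    (hpos : ∀ ξ : Lp ℂ 2 (volume.restrict (Icc (-(Real.log 2 / 2)) (Real.log 2 / 2))),
      0 ≤ RCLike.re ⟪ξ, ξ - windowOp (-(Real.log 2 / 2)) (Real.log 2 / 2) (integrableOn_varpi hG _ _) ξ⟫_ℂ
            + a₀ * ‖⟪constVector (-(Real.log 2 / 2)) (Real.log 2 / 2), ξ⟫_ℂ‖ ^ 2)
    (hg : IsWeilTest g) (hgs : tsupport g ⊆ Icc (-(Real.log 2 / 2)) (Real.log 2 / 2))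
    (h0 : mulFourier g (-(I / 2)) = 0)
    {n : ℕ} (ξ : Fin n → Lp ℂ 2 (volume : Measure ℝ))
    (hTr : ∑ i, (soninTraceForm (weilConv g (weilReflect g)) (ξ i : ℝ → ℂ)).re
        ≤ (archW (weilConv g (weilReflect g))).re
          + (evenFunctional G (weilConv g (weilReflect g))).re) :
    ∑ i, (soninTraceForm (weilConv g (weilReflect g)) (ξ i : ℝ → ℂ)).re
        - 8 * a₀ * e' / Real.log 2 * ‖mulFourier g 0‖ ^ 2
      ≤ (archW (weilConv g (weilReflect g))).re := by
  have hG0 : deriv G 0 ≠ 0 := by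
    rw [hGe]; exact_mod_cast he'.ne'
  have h := soninTrace_sub_le_archW_of_negativity hG hG0
    (re_inner_opN_le_of_opIneq hG hGe he'.le hpos) hg hgs h0 ξ hTr
  have e : 4 * (2 * a₀ * e') / Real.log 2 = 8 * a₀ * e' / Real.log 2 := by ring
  rw [e] at h
  exact h

/-- **Connes–Consani 2021, eq. (4) (Intro p. 4) = the named fact `WeilArchPositivity_soninTrace_fine`,
DERIVED from the residual printed inputs**: (H-TF) Theorem 4.7's (sonine1thm) for every `f = g ∗ g*`,
`g ∈ C_c^∞` supported in `[−½log 2, ½log 2]` (weak-trace form), (H-ε) `E = E₊` with even `C²` density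
`G(|x|)`, `G′(0) ≠ 0`, (H-NI) Lemma 6.10's `Re⟨ξ|N_I ξ⟩ ≤ γ|⟨η₀|ξ⟩|²` on `L²(I)`, and `4γ/log 2 < 17`.
The printed hypothesis "vanishing at `−i/2`" (Thm. 6.11) and the Intro's "at `i/2`" are interchanged by
`g ↦ g*` (`weilArchPositivity_soninTrace_fine_iff_neg_I_half`).
[cite: ConnesConsani2021, eq. (4) p. 4; Thm. 6.11 §6.7 pp. 28–29] -/
theorem weilArchPositivity_soninTrace_fine_of_negativity {γ : ℝ} (hG : ContDiff ℝ 2 G)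
    (hG0 : deriv G 0 ≠ 0)
    (hNI : ∀ ξ : Lp ℂ 2 (volume.restrict (Icc (-(Real.log 2 / 2)) (Real.log 2 / 2))),
      RCLike.re ⟪ξ, opN hG (-(Real.log 2 / 2)) (Real.log 2 / 2) ξ⟫_ℂ
        ≤ γ * ‖⟪constVector (-(Real.log 2 / 2)) (Real.log 2 / 2), ξ⟫_ℂ‖ ^ 2)
    (hc : 4 * γ / Real.log 2 < 17)
    (hTr : ∀ g : ℝ → ℂ, IsWeilTest g → tsupport g ⊆ Icc (-(Real.log 2 / 2)) (Real.log 2 / 2) →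
      ∀ (n : ℕ) (ξ : Fin n → Lp ℂ 2 (volume : Measure ℝ)),
        Orthonormal ℂ ξ → (∀ i, ξ i ∈ soninSpace 1 1) →
          ∑ i, (soninTraceForm (weilConv g (weilReflect g)) (ξ i : ℝ → ℂ)).re
            ≤ (archW (weilConv g (weilReflect g))).re
              + (evenFunctional G (weilConv g (weilReflect g))).re) :
    WeilArchPositivity_soninTrace_fine := by
  rw [weilArchPositivity_soninTrace_fine_iff_neg_I_half]
  exact ⟨_, hc, fun g hg hgs h0 n ξ hξ hS ↦
    soninTrace_sub_le_archW_of_negativity hG hG0 hNI hg hgs h0 ξ (hTr g hg hgs n ξ hξ hS)⟩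

/-- **Eq. (4) = `WeilArchPositivity_soninTrace_fine` from (H-TF), (H-ε) with `G′(0) = e′ > 0`, the
sign-free operator inequality (H-op) `⟨ξ|(1 − 𝐊_I)ξ⟩ + a₀|⟨η₀|ξ⟩|² ≥ 0` on `L²(I)`, and the arithmetic
`8a₀e′/log 2 < 17`** (printed values: `printedConstants_mainInequality`).
[cite: ConnesConsani2021, eq. (4) p. 4; Thm. 6.11 §6.7 pp. 28–29; Lemma 6.10 p. 28] -/
theorem weilArchPositivity_soninTrace_fine_of_opIneq {a₀ e' : ℝ} (hG : ContDiff ℝ 2 G)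
    (hGe : deriv G 0 = e') (he' : 0 < e')
    (hpos : ∀ ξ : Lp ℂ 2 (volume.restrict (Icc (-(Real.log 2 / 2)) (Real.log 2 / 2))),
      0 ≤ RCLike.re ⟪ξ, ξ - windowOp (-(Real.log 2 / 2)) (Real.log 2 / 2) (integrableOn_varpi hG _ _) ξ⟫_ℂ
            + a₀ * ‖⟪constVector (-(Real.log 2 / 2)) (Real.log 2 / 2), ξ⟫_ℂ‖ ^ 2)
    (hc : 8 * a₀ * e' / Real.log 2 < 17)
    (hTr : ∀ g : ℝ → ℂ, IsWeilTest g → tsupport g ⊆ Icc (-(Real.log 2 / 2)) (Real.log 2 / 2) →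
      ∀ (n : ℕ) (ξ : Fin n → Lp ℂ 2 (volume : Measure ℝ)),
        Orthonormal ℂ ξ → (∀ i, ξ i ∈ soninSpace 1 1) →
          ∑ i, (soninTraceForm (weilConv g (weilReflect g)) (ξ i : ℝ → ℂ)).re
            ≤ (archW (weilConv g (weilReflect g))).re
              + (evenFunctional G (weilConv g (weilReflect g))).re) :
    WeilArchPositivity_soninTrace_fine := by
  rw [weilArchPositivity_soninTrace_fine_iff_neg_I_half]
  exact ⟨_, hc, fun g hg hgs h0 n ξ hξ hS ↦
    soninTrace_sub_le_archW_of_opIneq hG hGe he' hpos hg hgs h0 ξ (hTr g hg hgs n ξ hξ hS)⟩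

/-- **Eq. (4) = `WeilArchPositivity_soninTrace_fine` from (H-TF), (H-ε) and the §6 SPECTRAL DATA as
printed** (Lemma 6.10's proof, p. 28): a symmetric `T` on `L²(I)` ("both `T` and `𝐊_I` are
self-adjoint") with top eigenpair `Tη = λ_max η`, `‖η‖ = 1`, `λ_max ≥ 1` (Lemma 6.4: `λ = 1.05158`),
`⟨ζ|Tζ⟩ ≤ λ₂‖ζ‖²` on `η^⊥` with `λ₂ ≤ 1` (Lemma 6.8 (iii): `λ₂ ≤ 0.772216`), `‖𝐊_I − T‖ ≤ ε₁`
(Fact 6.1 + Lemma 6.3: `ε₁ ≃ 0.00122`), `a₀ ≥ 0` with `ε₁ ≤ ε₂ = rankOneGap a₀ (λ_max − 1) (1 − λ₂) |⟨η|η₀⟩|`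
(Lemma 6.9; `a ≃ 0.064`, `ε₂ ≃ 0.00441`, `⟨η₀|η⟩ ≃ 0.94865`: Fact 6.5), and `8a₀e′/log 2 < 17`.  Every
numerical input is a hypothesis (floating point in print, uncertified there and here).
[cite: ConnesConsani2021, eq. (4) p. 4; Thm. 6.11 §6.7 pp. 28–29; Lemma 6.10 p. 28 (proof)] -/
theorem weilArchPositivity_soninTrace_fine_of_spectralData
    {T : Lp ℂ 2 (volume.restrict (Icc (-(Real.log 2 / 2)) (Real.log 2 / 2))) →L[ℂ]
      Lp ℂ 2 (volume.restrict (Icc (-(Real.log 2 / 2)) (Real.log 2 / 2)))}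
    {η : Lp ℂ 2 (volume.restrict (Icc (-(Real.log 2 / 2)) (Real.log 2 / 2)))}
    {lmax l₂ a₀ ε₁ e' : ℝ} (hG : ContDiff ℝ 2 G) (hGe : deriv G 0 = e') (he' : 0 < e')
    (hη : ‖η‖ = 1) (hlmax : 1 ≤ lmax) (hl₂ : l₂ ≤ 1) (ha₀ : 0 ≤ a₀)
    (hsa : ∀ x y : Lp ℂ 2 (volume.restrict (Icc (-(Real.log 2 / 2)) (Real.log 2 / 2))),
      ⟪T x, y⟫_ℂ = ⟪x, T y⟫_ℂ) (heig : T η = ((lmax : ℝ) : ℂ) • η)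
    (hTl₂ : ∀ ζ : Lp ℂ 2 (volume.restrict (Icc (-(Real.log 2 / 2)) (Real.log 2 / 2))),
      ⟪η, ζ⟫_ℂ = 0 → RCLike.re ⟪ζ, T ζ⟫_ℂ ≤ l₂ * ‖ζ‖ ^ 2)
    (hKT : ‖windowOp (-(Real.log 2 / 2)) (Real.log 2 / 2) (integrableOn_varpi hG _ _) - T‖ ≤ ε₁)
    (hε : ε₁ ≤ rankOneGap a₀ (lmax - 1) (1 - l₂) ‖⟪η, constVector (-(Real.log 2 / 2)) (Real.log 2 / 2)⟫_ℂ‖)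
    (hc : 8 * a₀ * e' / Real.log 2 < 17)
    (hTr : ∀ g : ℝ → ℂ, IsWeilTest g → tsupport g ⊆ Icc (-(Real.log 2 / 2)) (Real.log 2 / 2) →
      ∀ (n : ℕ) (ξ : Fin n → Lp ℂ 2 (volume : Measure ℝ)),
        Orthonormal ℂ ξ → (∀ i, ξ i ∈ soninSpace 1 1) →
          ∑ i, (soninTraceForm (weilConv g (weilReflect g)) (ξ i : ℝ → ℂ)).re
            ≤ (archW (weilConv g (weilReflect g))).re
              + (evenFunctional G (weilConv g (weilReflect g))).re) :
    WeilArchPositivity_soninTrace_fine :=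
  weilArchPositivity_soninTrace_fine_of_opIneq hG hGe he'
    (fun ξ ↦ opIneq_of_selfAdjoint_eigenvector hη (norm_constVector neg_half_log_two_lt) hlmax hl₂
      ha₀ hsa heig hTl₂ hKT hε ξ) hc hTr

/-- **Connes–Consani 2021, Theorem 1 = the named fact `WeilArchPositivity_soninTrace`, DERIVED from
(H-TF), (H-ε) with `G′(0) = e′ > 0`, and positivity of `1 − 𝐊_I` on `η₀^⊥`** ("Since the evaluation of the
Fourier transform at `0` defines a character …", Intro p. 4; p. 29: `ĝ(0) = 0 ⇒ k̂(0) = 0 ⇒ ξ ⊥ η₀`, and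
then `E(f) = ⟨ξ|N_I ξ⟩ = −2ε′(1₊)⟨ξ|(1 − 𝐊_I)ξ⟩ ≤ 0`).  No constant is needed for this case.
[cite: ConnesConsani2021, Thm. 1 (Intro p. 4); Thm. 6.11 §6.7 pp. 28–29] -/
theorem weilArchPositivity_soninTrace_of_perp {e' : ℝ} (hG : ContDiff ℝ 2 G) (hGe : deriv G 0 = e')
    (he' : 0 < e')
    (hperp : ∀ ξ : Lp ℂ 2 (volume.restrict (Icc (-(Real.log 2 / 2)) (Real.log 2 / 2))),
      ⟪constVector (-(Real.log 2 / 2)) (Real.log 2 / 2), ξ⟫_ℂ = 0 →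
      0 ≤ RCLike.re ⟪ξ, ξ - windowOp (-(Real.log 2 / 2)) (Real.log 2 / 2) (integrableOn_varpi hG _ _) ξ⟫_ℂ)
    (hTr : ∀ g : ℝ → ℂ, IsWeilTest g → tsupport g ⊆ Icc (-(Real.log 2 / 2)) (Real.log 2 / 2) →
      ∀ (n : ℕ) (ξ : Fin n → Lp ℂ 2 (volume : Measure ℝ)),
        Orthonormal ℂ ξ → (∀ i, ξ i ∈ soninSpace 1 1) →
          ∑ i, (soninTraceForm (weilConv g (weilReflect g)) (ξ i : ℝ → ℂ)).re
            ≤ (archW (weilConv g (weilReflect g))).re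
              + (evenFunctional G (weilConv g (weilReflect g))).re) :
    WeilArchPositivity_soninTrace := by
  rw [weilArchPositivity_soninTrace_iff_neg_I_half]
  intro g hg hgs h0 h00 n ξ hξ hS
  obtain ⟨k, hk, hks, -, -, hkQ, hk0⟩ := exists_halfPrimitive hg hgs h0
  rw [h00, mul_zero] at hk0
  have hE := re_evenFunctional_opQ_autocorr_nonpos_of_perp hG hGe he' hk hks hk0 hperp
  rw [hkQ] at hE
  linarith [hTr g hg hgs n ξ hξ hS]

/-- **Theorem 1 from (H-TF), (H-ε) and the sign-free operator inequality (H-op)** (which contains the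
positivity of `1 − 𝐊_I` on `η₀^⊥`); equivalently, via `weilArchPositivity_soninTrace_of_fine`, from any
case of eq. (4). [cite: ConnesConsani2021, Thm. 1 (Intro p. 4); Thm. 6.11 §6.7 pp. 28–29] -/
theorem weilArchPositivity_soninTrace_of_opIneq {a₀ e' : ℝ} (hG : ContDiff ℝ 2 G)
    (hGe : deriv G 0 = e') (he' : 0 < e')
    (hpos : ∀ ξ : Lp ℂ 2 (volume.restrict (Icc (-(Real.log 2 / 2)) (Real.log 2 / 2))),
      0 ≤ RCLike.re ⟪ξ, ξ - windowOp (-(Real.log 2 / 2)) (Real.log 2 / 2) (integrableOn_varpi hG _ _) ξ⟫_ℂ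
            + a₀ * ‖⟪constVector (-(Real.log 2 / 2)) (Real.log 2 / 2), ξ⟫_ℂ‖ ^ 2)
    (hTr : ∀ g : ℝ → ℂ, IsWeilTest g → tsupport g ⊆ Icc (-(Real.log 2 / 2)) (Real.log 2 / 2) →
      ∀ (n : ℕ) (ξ : Fin n → Lp ℂ 2 (volume : Measure ℝ)),
        Orthonormal ℂ ξ → (∀ i, ξ i ∈ soninSpace 1 1) →
          ∑ i, (soninTraceForm (weilConv g (weilReflect g)) (ξ i : ℝ → ℂ)).re
            ≤ (archW (weilConv g (weilReflect g))).re
              + (evenFunctional G (weilConv g (weilReflect g))).re) :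
    WeilArchPositivity_soninTrace :=
  weilArchPositivity_soninTrace_of_perp hG hGe he'
    (fun _ hξ ↦ re_inner_sub_nonneg_of_opIneq hpos hξ) hTr

/-- **The printed constants of Lemma 6.10 / Theorem 6.11, arithmetic only** (p. 28: `a ≃ 0.064`,
Lemma 5.4: `ε′(1₊)` "of the order of `22.9965`", `γ = 2aε′(1₊) ≃ 2.94355`; p. 28/Intro:
`c = 4γ/log 2` with `13 < c < 17`): at the exact decimals, `γ = 2.943552` and
`16.98 < c = 8·0.064·22.9965/log 2 < 17` (the printed value sits `0.08 %` below `17`).  Certified with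
Mathlib's `0.6931471803 < log 2 < 0.6931471808`; the decimals themselves are floating-point outputs of the
source, uncertified there and here. [cite: ConnesConsani2021, Lemma 6.10 §6.7 p. 28; Thm. 6.11 p. 28; eq. (4) p. 4] -/
theorem printedConstants_mainInequality :
    2 * (0.064 : ℝ) * 22.9965 = 2.943552 ∧
      (16.98 : ℝ) < 8 * 0.064 * 22.9965 / Real.log 2 ∧
      8 * (0.064 : ℝ) * 22.9965 / Real.log 2 < 17 := by
  have h1 := Real.log_two_gt_d9
  have h2 := Real.log_two_lt_d9
  have hpos : (0 : ℝ) < Real.log 2 := by linarith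
  refine ⟨by norm_num, ?_, ?_⟩
  · rw [lt_div_iff₀ hpos]
    linarith
  · rw [div_lt_iff₀ hpos]
    linarith

end MainInequality

end Literature.NumberTheory.ConnesConsani2021

end
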